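import Summits.KontsevichZagierPeriods.Zeta5Search.WedgeDictionaryThreeTerm
import Summits.KontsevichZagierPeriods.Zeta5Search.WedgeDictionaryKernelCells
import Summits.KontsevichZagierPeriods.Zeta5Search.WedgeDictionaryKernelCellsStar12
import Summits.KontsevichZagierPeriods.Zeta5Search.WedgeDictionaryKernelCellsTerms

/-!
# (H1)-free NATIVE cellular relation `star34` with symbolic parameters, from F1 + F2 (cell `pub-zeta5`, lineage gen-1, g21)

HONEST FRAMING: systematic search; no irrationality claim unless certified.  Structure of gen-1's OPEN dictionary node
`WedgeDictionary.explicitPQ` only; nothing about linear forms or ζ(5); nothing is evaluated.  PROVED, for SYMBOLIC `a : Fin 8 → ℤ`: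
`cellStar_native_34` — the conclusion of the tree node `CellStar` (`WedgeDictionaryThreeTerm.lean`) at `(a, i, k) = (a, 3, 4)`:
`ThreeTermRel (starKappa (bOfA a) 3 4) (-fanCoeff (bOfA a) 4) (fanCoeff (bOfA a) 3) a (a + slotDown 4) (a + slotDown 3)`,
a NATIVE star pair (both slots in S = {3,4,5}): three family kernels on ONE common contour, no virtual point.
Hypotheses: F1 (`cellularIntegral_eq_cubicalIntegral`, `cubicalIntegral_eq_Jintegral`), F2 (`barnes_double`), `Converges` of the three members and
`ChamberQ (pOf x) (qOf x) c₁ c₂` of the three members at ONE rational `(c₁,c₂)` (decidable per instance).  Proof: the pointwise kernel identity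
`kernel_star34` (Γ-functional-equation algebra; generated and exactly self-checked by the cell's `code/gen1/g21/cellgen.py`) fed to
`KernelCells.jsum_of_kernel` (`WedgeDictionaryKernelCells.lean`), then F1 and the prefactor in Γ-form.  No (H1), no invariance group; the
bookkeeping to the `@[conjecture]` node itself (hypotheses `RegionHyp`) is NOT done here.
-/

set_option maxHeartbeats 8000000
set_option linter.unusedSimpArgs false
set_option linter.unusedTactic false
set_option linter.unreachableTactic false
set_option linter.unnecessarySeqFocus false
set_option linter.style.longLine false
set_option linter.unusedVariables false

namespace Summit.KontsevichZagierPeriods.Zeta5Search.WedgeDictionary.KernelCells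

open Literature.NumberTheory.Irrationality.BrownZudilin2022 MeasureTheory
open Summit.KontsevichZagierPeriods.Zeta5Search.WedgeDictionary.Kernel

/-- Flat kernel identity of cell `star34`: `Σ_x coef_x · KΓ_x · Φ_x ≡ 0` (3 terms). -/
theorem kernel_star34 (a : Fin 8 → ℤ) (s t : ℂ) (hz_kk_a4_1 : ((a 4 : ℂ) + 1 : ℂ) ≠ 0) (hz_kk_a4a5ma7_1 : ((a 4 : ℂ) + (a 5 : ℂ) - (a 7 : ℂ) + 1 : ℂ) ≠ 0) (hz_kk_a3_0 : ((a 3 : ℂ) : ℂ) ≠ 0) (hz_ps_a4a5ma7_1 : (s + (a 4 : ℂ) + (a 5 : ℂ) - (a 7 : ℂ) + 1 : ℂ) ≠ 0) (hz_ps_a4a5_2 : (s + (a 4 : ℂ) + (a 5 : ℂ) + 2 : ℂ) ≠ 0) (hz_ps_a1a2ma3a5ma7_1 : (s + (a 1 : ℂ) + (a 2 : ℂ) - (a 3 : ℂ) + (a 5 : ℂ) - (a 7 : ℂ) + 1 : ℂ) ≠ 0) :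
    (((-(a 1 : ℂ) - (a 2 : ℂ) + (a 3 : ℂ) + (a 4 : ℂ)) * ((a 4 : ℂ) + 1)) * (Complex.Gamma ((a 3 : ℂ) + 1) * Complex.Gamma ((a 4 : ℂ) + 1) * Complex.Gamma ((a 0 : ℂ) + 1) * Complex.Gamma ((a 1 : ℂ) + 1) / (Complex.Gamma ((a 4 : ℂ) + (a 5 : ℂ) - (a 7 : ℂ) + 1) * Complex.Gamma ((a 0 : ℂ) + (a 1 : ℂ) - (a 3 : ℂ) + (a 5 : ℂ) - (a 7 : ℂ) + 1) * Complex.Gamma ((a 3 : ℂ) - (a 5 : ℂ) + (a 7 : ℂ) + 1)))) * barnesKernel ![a 4 + a 5 - a 7, a 1 + a 2 - a 3 + a 5 - a 7, a 5, a 1 + a 2 + a 5 - a 7, a 6, a 2 + a 5 - a 7, a 0 + a 1 - a 3 + a 5 - a 7] ![a 3, a 4, a 0 - a 2 + a 4, a 0, a 1] s t +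
      ((-((-(a 1 : ℂ) - (a 2 : ℂ) + (a 3 : ℂ) + (a 4 : ℂ) + (a 7 : ℂ) + 1) * ((a 4 : ℂ) + (a 5 : ℂ) - (a 7 : ℂ) + 1))) * (Complex.Gamma ((a 3 : ℂ) + 1) * Complex.Gamma ((a 4 : ℂ) + 2) * Complex.Gamma ((a 0 : ℂ) + 1) * Complex.Gamma ((a 1 : ℂ) + 1) / (Complex.Gamma ((a 4 : ℂ) + (a 5 : ℂ) - (a 7 : ℂ) + 2) * Complex.Gamma ((a 0 : ℂ) + (a 1 : ℂ) - (a 3 : ℂ) + (a 5 : ℂ) - (a 7 : ℂ) + 1) * Complex.Gamma ((a 3 : ℂ) - (a 5 : ℂ) + (a 7 : ℂ) + 1)))) * barnesKernel ![a 4 + a 5 - a 7 + 1, a 1 + a 2 - a 3 + a 5 - a 7, a 5, a 1 + a 2 + a 5 - a 7, a 6, a 2 + a 5 - a 7, a 0 + a 1 - a 3 + a 5 - a 7] ![a 3, a 4 + 1, a 0 - a 2 + a 4 + 1, a 0, a 1] s t +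
      ((((a 3 : ℂ)) * ((a 7 : ℂ) + 1)) * (Complex.Gamma ((a 3 : ℂ)) * Complex.Gamma ((a 4 : ℂ) + 2) * Complex.Gamma ((a 0 : ℂ) + 1) * Complex.Gamma ((a 1 : ℂ) + 1) / (Complex.Gamma ((a 4 : ℂ) + (a 5 : ℂ) - (a 7 : ℂ) + 1) * Complex.Gamma ((a 0 : ℂ) + (a 1 : ℂ) - (a 3 : ℂ) + (a 5 : ℂ) - (a 7 : ℂ) + 1) * Complex.Gamma ((a 3 : ℂ) - (a 5 : ℂ) + (a 7 : ℂ) + 1)))) * barnesKernel ![a 4 + a 5 - a 7, a 1 + a 2 - a 3 + a 5 - a 7 + 1, a 5, a 1 + a 2 + a 5 - a 7, a 6, a 2 + a 5 - a 7, a 0 + a 1 - a 3 + a 5 - a 7] ![a 3 - 1, a 4 + 1, a 0 - a 2 + a 4, a 0, a 1] s t = 0 := by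
  rw [kterm_star12_0 a s t, kterm_slotDown4 a s t, kterm_slotDown3 a s t]
  have hG_kk_a4_2 : Complex.Gamma ((a 4 : ℂ) + 2) = ((a 4 : ℂ) + 1) * Complex.Gamma ((a 4 : ℂ) + 1) := by
    have h' := Complex.Gamma_add_one ((a 4 : ℂ) + 1) hz_kk_a4_1
    rw [show ((a 4 : ℂ) + 1 : ℂ) + 1 = (a 4 : ℂ) + 2 by ring] at h'
    exact h'
  have hG_kk_a4a5ma7_2 : Complex.Gamma ((a 4 : ℂ) + (a 5 : ℂ) - (a 7 : ℂ) + 2) = ((a 4 : ℂ) + (a 5 : ℂ) - (a 7 : ℂ) + 1) * Complex.Gamma ((a 4 : ℂ) + (a 5 : ℂ) - (a 7 : ℂ) + 1) := by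
    have h' := Complex.Gamma_add_one ((a 4 : ℂ) + (a 5 : ℂ) - (a 7 : ℂ) + 1) hz_kk_a4a5ma7_1
    rw [show ((a 4 : ℂ) + (a 5 : ℂ) - (a 7 : ℂ) + 1 : ℂ) + 1 = (a 4 : ℂ) + (a 5 : ℂ) - (a 7 : ℂ) + 2 by ring] at h'
    exact h'
  have hG_kk_a3_1 : Complex.Gamma ((a 3 : ℂ) + 1) = ((a 3 : ℂ)) * Complex.Gamma ((a 3 : ℂ)) := by
    have h' := Complex.Gamma_add_one ((a 3 : ℂ)) hz_kk_a3_0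
    rw [show ((a 3 : ℂ) : ℂ) + 1 = (a 3 : ℂ) + 1 by ring] at h'
    exact h'
  have hG_ps_a4a5ma7_2 : Complex.Gamma (s + (a 4 : ℂ) + (a 5 : ℂ) - (a 7 : ℂ) + 2) = (s + (a 4 : ℂ) + (a 5 : ℂ) - (a 7 : ℂ) + 1) * Complex.Gamma (s + (a 4 : ℂ) + (a 5 : ℂ) - (a 7 : ℂ) + 1) := by
    have h' := Complex.Gamma_add_one (s + (a 4 : ℂ) + (a 5 : ℂ) - (a 7 : ℂ) + 1) hz_ps_a4a5ma7_1
    rw [show (s + (a 4 : ℂ) + (a 5 : ℂ) - (a 7 : ℂ) + 1 : ℂ) + 1 = s + (a 4 : ℂ) + (a 5 : ℂ) - (a 7 : ℂ) + 2 by ring] at h'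
    exact h'
  have hG_ps_a4a5_3 : Complex.Gamma (s + (a 4 : ℂ) + (a 5 : ℂ) + 3) = (s + (a 4 : ℂ) + (a 5 : ℂ) + 2) * Complex.Gamma (s + (a 4 : ℂ) + (a 5 : ℂ) + 2) := by
    have h' := Complex.Gamma_add_one (s + (a 4 : ℂ) + (a 5 : ℂ) + 2) hz_ps_a4a5_2
    rw [show (s + (a 4 : ℂ) + (a 5 : ℂ) + 2 : ℂ) + 1 = s + (a 4 : ℂ) + (a 5 : ℂ) + 3 by ring] at h'
    exact h'
  have hG_ps_a1a2ma3a5ma7_2 : Complex.Gamma (s + (a 1 : ℂ) + (a 2 : ℂ) - (a 3 : ℂ) + (a 5 : ℂ) - (a 7 : ℂ) + 2) = (s + (a 1 : ℂ) + (a 2 : ℂ) - (a 3 : ℂ) + (a 5 : ℂ) - (a 7 : ℂ) + 1) * Complex.Gamma (s + (a 1 : ℂ) + (a 2 : ℂ) - (a 3 : ℂ) + (a 5 : ℂ) - (a 7 : ℂ) + 1) := by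
    have h' := Complex.Gamma_add_one (s + (a 1 : ℂ) + (a 2 : ℂ) - (a 3 : ℂ) + (a 5 : ℂ) - (a 7 : ℂ) + 1) hz_ps_a1a2ma3a5ma7_1
    rw [show (s + (a 1 : ℂ) + (a 2 : ℂ) - (a 3 : ℂ) + (a 5 : ℂ) - (a 7 : ℂ) + 1 : ℂ) + 1 = s + (a 1 : ℂ) + (a 2 : ℂ) - (a 3 : ℂ) + (a 5 : ℂ) - (a 7 : ℂ) + 2 by ring] at h'
    exact h'
  rw [hG_kk_a4_2, hG_kk_a4a5ma7_2, hG_kk_a3_1, hG_ps_a4a5ma7_2, hG_ps_a4a5_3, hG_ps_a1a2ma3a5ma7_2]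
  by_cases hGd0 : Complex.Gamma (s + (a 1 : ℂ) + (a 2 : ℂ) + (a 5 : ℂ) - (a 7 : ℂ) + 2) = 0
  · simp [hGd0]
  by_cases hGd1 : Complex.Gamma (s + (a 4 : ℂ) + (a 5 : ℂ) + 2) = 0
  · simp [hGd1]
  by_cases hGd2 : Complex.Gamma (t + (a 0 : ℂ) + (a 6 : ℂ) + 2) = 0
  · simp [hGd2]
  by_cases hGd3 : Complex.Gamma (t + (a 1 : ℂ) + (a 2 : ℂ) + (a 5 : ℂ) - (a 7 : ℂ) + 2) = 0
  · simp [hGd3]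
  by_cases hGd4 : Complex.Gamma ((a 4 : ℂ) + (a 5 : ℂ) - (a 7 : ℂ) + 1) = 0
  · simp [hGd4]
  by_cases hGd5 : Complex.Gamma ((a 0 : ℂ) + (a 1 : ℂ) - (a 3 : ℂ) + (a 5 : ℂ) - (a 7 : ℂ) + 1) = 0
  · simp [hGd5]
  by_cases hGd6 : Complex.Gamma ((a 3 : ℂ) - (a 5 : ℂ) + (a 7 : ℂ) + 1) = 0
  · simp [hGd6]
  field_simp
  ring

/-- Letters, contour shifts and coefficients `κ_x = coef_x · KΓ_x` of cell `star34` as `Fin 3`-indexed data. -/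
def Pv_star34 (a : Fin 8 → ℤ) : Fin 3 → Fin 7 → ℤ := ![![a 4 + a 5 - a 7, a 1 + a 2 - a 3 + a 5 - a 7, a 5, a 1 + a 2 + a 5 - a 7, a 6, a 2 + a 5 - a 7, a 0 + a 1 - a 3 + a 5 - a 7], ![a 4 + a 5 - a 7 + 1, a 1 + a 2 - a 3 + a 5 - a 7, a 5, a 1 + a 2 + a 5 - a 7, a 6, a 2 + a 5 - a 7, a 0 + a 1 - a 3 + a 5 - a 7], ![a 4 + a 5 - a 7, a 1 + a 2 - a 3 + a 5 - a 7 + 1, a 5, a 1 + a 2 + a 5 - a 7, a 6, a 2 + a 5 - a 7, a 0 + a 1 - a 3 + a 5 - a 7]]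
/-- The `q`-letters of the 3 kernel terms of cell `star34`. -/
def Qv_star34 (a : Fin 8 → ℤ) : Fin 3 → Fin 5 → ℤ := ![![a 3, a 4, a 0 - a 2 + a 4, a 0, a 1], ![a 3, a 4 + 1, a 0 - a 2 + a 4 + 1, a 0, a 1], ![a 3 - 1, a 4 + 1, a 0 - a 2 + a 4, a 0, a 1]]
/-- First-variable contour shifts of the 3 kernel terms of cell `star34`. -/
def n1v_star34 : Fin 3 → ℤ := ![0, 0, 0]
/-- Second-variable contour shifts of the 3 kernel terms of cell `star34`. -/
def n2v_star34 : Fin 3 → ℤ := ![0, 0, 0]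
/-- The coefficients `κ_x = coef_x · KΓ_x` of the 3 kernel terms of cell `star34`. -/
noncomputable def κv_star34 (a : Fin 8 → ℤ) : Fin 3 → ℂ :=
  ![(((-(a 1 : ℂ) - (a 2 : ℂ) + (a 3 : ℂ) + (a 4 : ℂ)) * ((a 4 : ℂ) + 1))) * (Complex.Gamma ((a 3 : ℂ) + 1) * Complex.Gamma ((a 4 : ℂ) + 1) * Complex.Gamma ((a 0 : ℂ) + 1) * Complex.Gamma ((a 1 : ℂ) + 1) / (Complex.Gamma ((a 4 : ℂ) + (a 5 : ℂ) - (a 7 : ℂ) + 1) * Complex.Gamma ((a 0 : ℂ) + (a 1 : ℂ) - (a 3 : ℂ) + (a 5 : ℂ) - (a 7 : ℂ) + 1) * Complex.Gamma ((a 3 : ℂ) - (a 5 : ℂ) + (a 7 : ℂ) + 1))),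
    ((-((-(a 1 : ℂ) - (a 2 : ℂ) + (a 3 : ℂ) + (a 4 : ℂ) + (a 7 : ℂ) + 1) * ((a 4 : ℂ) + (a 5 : ℂ) - (a 7 : ℂ) + 1)))) * (Complex.Gamma ((a 3 : ℂ) + 1) * Complex.Gamma ((a 4 : ℂ) + 2) * Complex.Gamma ((a 0 : ℂ) + 1) * Complex.Gamma ((a 1 : ℂ) + 1) / (Complex.Gamma ((a 4 : ℂ) + (a 5 : ℂ) - (a 7 : ℂ) + 2) * Complex.Gamma ((a 0 : ℂ) + (a 1 : ℂ) - (a 3 : ℂ) + (a 5 : ℂ) - (a 7 : ℂ) + 1) * Complex.Gamma ((a 3 : ℂ) - (a 5 : ℂ) + (a 7 : ℂ) + 1))),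
    ((((a 3 : ℂ)) * ((a 7 : ℂ) + 1))) * (Complex.Gamma ((a 3 : ℂ)) * Complex.Gamma ((a 4 : ℂ) + 2) * Complex.Gamma ((a 0 : ℂ) + 1) * Complex.Gamma ((a 1 : ℂ) + 1) / (Complex.Gamma ((a 4 : ℂ) + (a 5 : ℂ) - (a 7 : ℂ) + 1) * Complex.Gamma ((a 0 : ℂ) + (a 1 : ℂ) - (a 3 : ℂ) + (a 5 : ℂ) - (a 7 : ℂ) + 1) * Complex.Gamma ((a 3 : ℂ) - (a 5 : ℂ) + (a 7 : ℂ) + 1)))]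

/-- The kernel identity of cell `star34` in the `Fin 3`-indexed form consumed by `jsum_of_kernel`. -/
theorem kernel_star34_sum (a : Fin 8 → ℤ) (s t : ℂ) (hz_kk_a4_1 : ((a 4 : ℂ) + 1 : ℂ) ≠ 0) (hz_kk_a4a5ma7_1 : ((a 4 : ℂ) + (a 5 : ℂ) - (a 7 : ℂ) + 1 : ℂ) ≠ 0) (hz_kk_a3_0 : ((a 3 : ℂ) : ℂ) ≠ 0) (hz_ps_a4a5ma7_1 : (s + (a 4 : ℂ) + (a 5 : ℂ) - (a 7 : ℂ) + 1 : ℂ) ≠ 0) (hz_ps_a4a5_2 : (s + (a 4 : ℂ) + (a 5 : ℂ) + 2 : ℂ) ≠ 0) (hz_ps_a1a2ma3a5ma7_1 : (s + (a 1 : ℂ) + (a 2 : ℂ) - (a 3 : ℂ) + (a 5 : ℂ) - (a 7 : ℂ) + 1 : ℂ) ≠ 0) :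
    ∑ i, κv_star34 a i * barnesKernel (Pv_star34 a i) (Qv_star34 a i) (s - ((n1v_star34 i : ℤ) : ℂ)) (t - ((n2v_star34 i : ℤ) : ℂ)) = 0 := by
  simp only [Fin.sum_univ_succ, Fin.sum_univ_zero, add_zero, Pv_star34, Qv_star34, κv_star34, n1v_star34, n2v_star34,
    Matrix.cons_val_zero, Matrix.cons_val_succ, Int.cast_zero, Int.cast_one, Int.cast_ofNat, sub_zero]
  have hk := kernel_star34 a s t hz_kk_a4_1 hz_kk_a4a5ma7_1 hz_kk_a3_0 hz_ps_a4a5ma7_1 hz_ps_a4a5_2 hz_ps_a1a2ma3a5ma7_1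
  linear_combination hk

/-- **Native STAR(3,4)** from F1 + F2 alone, for SYMBOLIC parameters: if the three family points converge and share a rational chamber
point `(c₁,c₂)`, the `CellStar` relation holds among their cellular integrals. -/
theorem cellStar_native_34
    (h8 : cellularIntegral_eq_cubicalIntegral) (h10 : cubicalIntegral_eq_Jintegral) (hF2 : barnes_double)
    (a : Fin 8 → ℤ) (c₁ c₂ : ℚ) (hc0 : Converges a) (hc1 : Converges (a + slotDown 4)) (hc2 : Converges (a + slotDown 3))
    (hch0 : ChamberQ (pOf a) (qOf a) c₁ c₂)
    (hch1 : ChamberQ (pOf (a + slotDown 4)) (qOf (a + slotDown 4)) c₁ c₂)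
    (hch2 : ChamberQ (pOf (a + slotDown 3)) (qOf (a + slotDown 3)) c₁ c₂) :
    ThreeTermRel (starKappa (bOfA a) 3 4) (-fanCoeff (bOfA a) 4) (fanCoeff (bOfA a) 3) a (a + slotDown 4) (a + slotDown 3) := by
  have n0 := letters_nonneg hc0 hch0
  have eP0 : pOf a = ![a 4 + a 5 - a 7, a 1 + a 2 - a 3 + a 5 - a 7, a 5, a 1 + a 2 + a 5 - a 7, a 6, a 2 + a 5 - a 7, a 0 + a 1 - a 3 + a 5 - a 7] := by ext j; fin_cases j <;> simp [pOf] <;> omega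
  have eQ0 : qOf a = ![a 3, a 4, a 0 - a 2 + a 4, a 0, a 1] := by ext j; fin_cases j <;> simp [qOf] <;> omega
  rw [eP0, eQ0] at hch0 n0
  have n1 := letters_nonneg hc1 hch1
  have eP1 : pOf (a + slotDown 4) = ![a 4 + a 5 - a 7 + 1, a 1 + a 2 - a 3 + a 5 - a 7, a 5, a 1 + a 2 + a 5 - a 7, a 6, a 2 + a 5 - a 7, a 0 + a 1 - a 3 + a 5 - a 7] := by
    ext j; fin_cases j <;> simp only [pOf, Pi.add_apply] <;> simp [slotDown, dsUp] <;> omega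
  have eQ1 : qOf (a + slotDown 4) = ![a 3, a 4 + 1, a 0 - a 2 + a 4 + 1, a 0, a 1] := by
    ext j; fin_cases j <;> simp only [qOf, Pi.add_apply] <;> simp [slotDown, dsUp] <;> omega
  rw [eP1, eQ1] at hch1 n1
  have n2 := letters_nonneg hc2 hch2
  have eP2 : pOf (a + slotDown 3) = ![a 4 + a 5 - a 7, a 1 + a 2 - a 3 + a 5 - a 7 + 1, a 5, a 1 + a 2 + a 5 - a 7, a 6, a 2 + a 5 - a 7, a 0 + a 1 - a 3 + a 5 - a 7] := by
    ext j; fin_cases j <;> simp only [pOf, Pi.add_apply] <;> simp [slotDown, dsUp] <;> omega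
  have eQ2 : qOf (a + slotDown 3) = ![a 3 - 1, a 4 + 1, a 0 - a 2 + a 4, a 0, a 1] := by
    ext j; fin_cases j <;> simp only [qOf, Pi.add_apply] <;> simp [slotDown, dsUp] <;> omega
  rw [eP2, eQ2] at hch2 n2
  have Z0 : 0 ≤ a 4 + a 5 - a 7 := by have h := n0.1 0; simp at h; omega
  have Z1 : 0 ≤ a 1 + a 2 - a 3 + a 5 - a 7 := by have h := n0.1 1; simp at h; omega
  have Z2 : 0 ≤ a 5 := by have h := n0.1 2; simp at h; omega
  have Z3 : 0 ≤ a 1 + a 2 + a 5 - a 7 := by have h := n0.1 3; simp at h; omega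
  have Z4 : 0 ≤ a 6 := by have h := n0.1 4; simp at h; omega
  have Z5 : 0 ≤ a 2 + a 5 - a 7 := by have h := n0.1 5; simp at h; omega
  have Z6 : 0 ≤ a 0 + a 1 - a 3 + a 5 - a 7 := by have h := n0.1 6; simp at h; omega
  have Z7 : 0 ≤ a 3 := by have h := n0.2 0; simp at h; omega
  have Z8 : 0 ≤ a 4 := by have h := n0.2 1; simp at h; omega
  have Z9 : 0 ≤ a 0 - a 2 + a 4 := by have h := n0.2 2; simp at h; omega
  have Z10 : 0 ≤ a 0 := by have h := n0.2 3; simp at h; omega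
  have Z11 : 0 ≤ a 1 := by have h := n0.2 4; simp at h; omega
  have Z12 : 0 ≤ a 4 + a 5 - a 7 + 1 := by have h := n1.1 0; simp at h; omega
  have Z13 : 0 ≤ a 4 + 1 := by have h := n1.2 1; simp at h; omega
  have Z14 : 0 ≤ a 0 - a 2 + a 4 + 1 := by have h := n1.2 2; simp at h; omega
  have Z15 : 0 ≤ a 1 + a 2 - a 3 + a 5 - a 7 + 1 := by have h := n2.1 1; simp at h; omega
  have Z16 : 0 ≤ a 3 - 1 := by have h := n2.2 0; simp at h; omega
  have Zq0 : (0 : ℚ) ≤ (a 4 : ℚ) + (a 5 : ℚ) - (a 7 : ℚ) := by exact_mod_cast Z0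
  have Zr0 : (0 : ℝ) ≤ (a 4 : ℝ) + (a 5 : ℝ) - (a 7 : ℝ) := by exact_mod_cast Z0
  have Zq1 : (0 : ℚ) ≤ (a 1 : ℚ) + (a 2 : ℚ) - (a 3 : ℚ) + (a 5 : ℚ) - (a 7 : ℚ) := by exact_mod_cast Z1
  have Zr1 : (0 : ℝ) ≤ (a 1 : ℝ) + (a 2 : ℝ) - (a 3 : ℝ) + (a 5 : ℝ) - (a 7 : ℝ) := by exact_mod_cast Z1
  have Zq2 : (0 : ℚ) ≤ (a 5 : ℚ) := by exact_mod_cast Z2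
  have Zr2 : (0 : ℝ) ≤ (a 5 : ℝ) := by exact_mod_cast Z2
  have Zq3 : (0 : ℚ) ≤ (a 1 : ℚ) + (a 2 : ℚ) + (a 5 : ℚ) - (a 7 : ℚ) := by exact_mod_cast Z3
  have Zr3 : (0 : ℝ) ≤ (a 1 : ℝ) + (a 2 : ℝ) + (a 5 : ℝ) - (a 7 : ℝ) := by exact_mod_cast Z3
  have Zq4 : (0 : ℚ) ≤ (a 6 : ℚ) := by exact_mod_cast Z4
  have Zr4 : (0 : ℝ) ≤ (a 6 : ℝ) := by exact_mod_cast Z4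
  have Zq5 : (0 : ℚ) ≤ (a 2 : ℚ) + (a 5 : ℚ) - (a 7 : ℚ) := by exact_mod_cast Z5
  have Zr5 : (0 : ℝ) ≤ (a 2 : ℝ) + (a 5 : ℝ) - (a 7 : ℝ) := by exact_mod_cast Z5
  have Zq6 : (0 : ℚ) ≤ (a 0 : ℚ) + (a 1 : ℚ) - (a 3 : ℚ) + (a 5 : ℚ) - (a 7 : ℚ) := by exact_mod_cast Z6
  have Zr6 : (0 : ℝ) ≤ (a 0 : ℝ) + (a 1 : ℝ) - (a 3 : ℝ) + (a 5 : ℝ) - (a 7 : ℝ) := by exact_mod_cast Z6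
  have Zq7 : (0 : ℚ) ≤ (a 3 : ℚ) := by exact_mod_cast Z7
  have Zr7 : (0 : ℝ) ≤ (a 3 : ℝ) := by exact_mod_cast Z7
  have Zq8 : (0 : ℚ) ≤ (a 4 : ℚ) := by exact_mod_cast Z8
  have Zr8 : (0 : ℝ) ≤ (a 4 : ℝ) := by exact_mod_cast Z8
  have Zq9 : (0 : ℚ) ≤ (a 0 : ℚ) - (a 2 : ℚ) + (a 4 : ℚ) := by exact_mod_cast Z9
  have Zr9 : (0 : ℝ) ≤ (a 0 : ℝ) - (a 2 : ℝ) + (a 4 : ℝ) := by exact_mod_cast Z9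
  have Zq10 : (0 : ℚ) ≤ (a 0 : ℚ) := by exact_mod_cast Z10
  have Zr10 : (0 : ℝ) ≤ (a 0 : ℝ) := by exact_mod_cast Z10
  have Zq11 : (0 : ℚ) ≤ (a 1 : ℚ) := by exact_mod_cast Z11
  have Zr11 : (0 : ℝ) ≤ (a 1 : ℝ) := by exact_mod_cast Z11
  have Zq12 : (0 : ℚ) ≤ (a 4 : ℚ) + (a 5 : ℚ) - (a 7 : ℚ) + 1 := by exact_mod_cast Z12
  have Zr12 : (0 : ℝ) ≤ (a 4 : ℝ) + (a 5 : ℝ) - (a 7 : ℝ) + 1 := by exact_mod_cast Z12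
  have Zq13 : (0 : ℚ) ≤ (a 4 : ℚ) + 1 := by exact_mod_cast Z13
  have Zr13 : (0 : ℝ) ≤ (a 4 : ℝ) + 1 := by exact_mod_cast Z13
  have Zq14 : (0 : ℚ) ≤ (a 0 : ℚ) - (a 2 : ℚ) + (a 4 : ℚ) + 1 := by exact_mod_cast Z14
  have Zr14 : (0 : ℝ) ≤ (a 0 : ℝ) - (a 2 : ℝ) + (a 4 : ℝ) + 1 := by exact_mod_cast Z14
  have Zq15 : (0 : ℚ) ≤ (a 1 : ℚ) + (a 2 : ℚ) - (a 3 : ℚ) + (a 5 : ℚ) - (a 7 : ℚ) + 1 := by exact_mod_cast Z15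
  have Zr15 : (0 : ℝ) ≤ (a 1 : ℝ) + (a 2 : ℝ) - (a 3 : ℝ) + (a 5 : ℝ) - (a 7 : ℝ) + 1 := by exact_mod_cast Z15
  have Zq16 : (0 : ℚ) ≤ (a 3 : ℚ) - 1 := by exact_mod_cast Z16
  have Zr16 : (0 : ℝ) ≤ (a 3 : ℝ) - 1 := by exact_mod_cast Z16
  obtain ⟨R0_0, R0_1, R0_2, R0_3, R0_4, R0_5, R0_6, R0_7, R0_8, R0_9⟩ := chamberQ_bounds hch0
  have Rq0_0 : (0 : ℚ) < (c₁ : ℚ) := by have h := R0_0; (try simp at h); linarith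
  have Rr0_0 : (0 : ℝ) < (c₁ : ℝ) := by exact_mod_cast Rq0_0
  have Rq0_1 : (c₁ : ℚ) < 1 + ((a 4 : ℚ) + (a 5 : ℚ) - (a 7 : ℚ)) := by have h := R0_1; (try simp at h); linarith
  have Rr0_1 : (c₁ : ℝ) < 1 + ((a 4 : ℝ) + (a 5 : ℝ) - (a 7 : ℝ)) := by exact_mod_cast Rq0_1
  have Rq0_2 : (c₁ : ℚ) < 1 + ((a 1 : ℚ) + (a 2 : ℚ) - (a 3 : ℚ) + (a 5 : ℚ) - (a 7 : ℚ)) := by have h := R0_2; (try simp at h); linarith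
  have Rr0_2 : (c₁ : ℝ) < 1 + ((a 1 : ℝ) + (a 2 : ℝ) - (a 3 : ℝ) + (a 5 : ℝ) - (a 7 : ℝ)) := by exact_mod_cast Rq0_2
  have Rq0_3 : (c₁ : ℚ) < 1 + ((a 5 : ℚ)) := by have h := R0_3; (try simp at h); linarith
  have Rr0_3 : (c₁ : ℝ) < 1 + ((a 5 : ℝ)) := by exact_mod_cast Rq0_3
  have Rq0_4 : (0 : ℚ) < (c₂ : ℚ) := by have h := R0_4; (try simp at h); linarith
  have Rr0_4 : (0 : ℝ) < (c₂ : ℝ) := by exact_mod_cast Rq0_4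
  have Rq0_5 : (c₂ : ℚ) < 1 + ((a 6 : ℚ)) := by have h := R0_5; (try simp at h); linarith
  have Rr0_5 : (c₂ : ℝ) < 1 + ((a 6 : ℝ)) := by exact_mod_cast Rq0_5
  have Rq0_6 : (c₂ : ℚ) < 1 + ((a 2 : ℚ) + (a 5 : ℚ) - (a 7 : ℚ)) := by have h := R0_6; (try simp at h); linarith
  have Rr0_6 : (c₂ : ℝ) < 1 + ((a 2 : ℝ) + (a 5 : ℝ) - (a 7 : ℝ)) := by exact_mod_cast Rq0_6
  have Rq0_7 : (c₂ : ℚ) < 1 + ((a 0 : ℚ) + (a 1 : ℚ) - (a 3 : ℚ) + (a 5 : ℚ) - (a 7 : ℚ)) := by have h := R0_7; (try simp at h); linarith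
  have Rr0_7 : (c₂ : ℝ) < 1 + ((a 0 : ℝ) + (a 1 : ℝ) - (a 3 : ℝ) + (a 5 : ℝ) - (a 7 : ℝ)) := by exact_mod_cast Rq0_7
  have Rq0_8 : (1 : ℚ) + ((a 4 : ℚ) + (a 5 : ℚ) - (a 7 : ℚ)) + ((a 0 : ℚ) + (a 1 : ℚ) - (a 3 : ℚ) + (a 5 : ℚ) - (a 7 : ℚ)) - ((a 0 : ℚ) - (a 2 : ℚ) + (a 4 : ℚ)) < (c₁ : ℚ) + (c₂ : ℚ) := by have h := R0_8; (try simp at h); linarith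
  have Rr0_8 : (1 : ℝ) + ((a 4 : ℝ) + (a 5 : ℝ) - (a 7 : ℝ)) + ((a 0 : ℝ) + (a 1 : ℝ) - (a 3 : ℝ) + (a 5 : ℝ) - (a 7 : ℝ)) - ((a 0 : ℝ) - (a 2 : ℝ) + (a 4 : ℝ)) < (c₁ : ℝ) + (c₂ : ℝ) := by exact_mod_cast Rq0_8
  have Rq0_9 : (c₁ : ℚ) + (c₂ : ℚ) < ((a 1 : ℚ) + (a 2 : ℚ) + (a 5 : ℚ) - (a 7 : ℚ)) + 2 := by have h := R0_9; (try simp at h); linarith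
  have Rr0_9 : (c₁ : ℝ) + (c₂ : ℝ) < ((a 1 : ℝ) + (a 2 : ℝ) + (a 5 : ℝ) - (a 7 : ℝ)) + 2 := by exact_mod_cast Rq0_9
  obtain ⟨R1_0, R1_1, R1_2, R1_3, R1_4, R1_5, R1_6, R1_7, R1_8, R1_9⟩ := chamberQ_bounds hch1
  have Rq1_0 : (0 : ℚ) < (c₁ : ℚ) := by have h := R1_0; (try simp at h); linarith
  have Rr1_0 : (0 : ℝ) < (c₁ : ℝ) := by exact_mod_cast Rq1_0
  have Rq1_1 : (c₁ : ℚ) < 1 + ((a 4 : ℚ) + (a 5 : ℚ) - (a 7 : ℚ) + 1) := by have h := R1_1; (try simp at h); linarith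
  have Rr1_1 : (c₁ : ℝ) < 1 + ((a 4 : ℝ) + (a 5 : ℝ) - (a 7 : ℝ) + 1) := by exact_mod_cast Rq1_1
  have Rq1_2 : (c₁ : ℚ) < 1 + ((a 1 : ℚ) + (a 2 : ℚ) - (a 3 : ℚ) + (a 5 : ℚ) - (a 7 : ℚ)) := by have h := R1_2; (try simp at h); linarith
  have Rr1_2 : (c₁ : ℝ) < 1 + ((a 1 : ℝ) + (a 2 : ℝ) - (a 3 : ℝ) + (a 5 : ℝ) - (a 7 : ℝ)) := by exact_mod_cast Rq1_2
  have Rq1_3 : (c₁ : ℚ) < 1 + ((a 5 : ℚ)) := by have h := R1_3; (try simp at h); linarith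
  have Rr1_3 : (c₁ : ℝ) < 1 + ((a 5 : ℝ)) := by exact_mod_cast Rq1_3
  have Rq1_4 : (0 : ℚ) < (c₂ : ℚ) := by have h := R1_4; (try simp at h); linarith
  have Rr1_4 : (0 : ℝ) < (c₂ : ℝ) := by exact_mod_cast Rq1_4
  have Rq1_5 : (c₂ : ℚ) < 1 + ((a 6 : ℚ)) := by have h := R1_5; (try simp at h); linarith
  have Rr1_5 : (c₂ : ℝ) < 1 + ((a 6 : ℝ)) := by exact_mod_cast Rq1_5
  have Rq1_6 : (c₂ : ℚ) < 1 + ((a 2 : ℚ) + (a 5 : ℚ) - (a 7 : ℚ)) := by have h := R1_6; (try simp at h); linarith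
  have Rr1_6 : (c₂ : ℝ) < 1 + ((a 2 : ℝ) + (a 5 : ℝ) - (a 7 : ℝ)) := by exact_mod_cast Rq1_6
  have Rq1_7 : (c₂ : ℚ) < 1 + ((a 0 : ℚ) + (a 1 : ℚ) - (a 3 : ℚ) + (a 5 : ℚ) - (a 7 : ℚ)) := by have h := R1_7; (try simp at h); linarith
  have Rr1_7 : (c₂ : ℝ) < 1 + ((a 0 : ℝ) + (a 1 : ℝ) - (a 3 : ℝ) + (a 5 : ℝ) - (a 7 : ℝ)) := by exact_mod_cast Rq1_7
  have Rq1_8 : (1 : ℚ) + ((a 4 : ℚ) + (a 5 : ℚ) - (a 7 : ℚ) + 1) + ((a 0 : ℚ) + (a 1 : ℚ) - (a 3 : ℚ) + (a 5 : ℚ) - (a 7 : ℚ)) - ((a 0 : ℚ) - (a 2 : ℚ) + (a 4 : ℚ) + 1) < (c₁ : ℚ) + (c₂ : ℚ) := by have h := R1_8; (try simp at h); linarith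
  have Rr1_8 : (1 : ℝ) + ((a 4 : ℝ) + (a 5 : ℝ) - (a 7 : ℝ) + 1) + ((a 0 : ℝ) + (a 1 : ℝ) - (a 3 : ℝ) + (a 5 : ℝ) - (a 7 : ℝ)) - ((a 0 : ℝ) - (a 2 : ℝ) + (a 4 : ℝ) + 1) < (c₁ : ℝ) + (c₂ : ℝ) := by exact_mod_cast Rq1_8
  have Rq1_9 : (c₁ : ℚ) + (c₂ : ℚ) < ((a 1 : ℚ) + (a 2 : ℚ) + (a 5 : ℚ) - (a 7 : ℚ)) + 2 := by have h := R1_9; (try simp at h); linarith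
  have Rr1_9 : (c₁ : ℝ) + (c₂ : ℝ) < ((a 1 : ℝ) + (a 2 : ℝ) + (a 5 : ℝ) - (a 7 : ℝ)) + 2 := by exact_mod_cast Rq1_9
  obtain ⟨R2_0, R2_1, R2_2, R2_3, R2_4, R2_5, R2_6, R2_7, R2_8, R2_9⟩ := chamberQ_bounds hch2
  have Rq2_0 : (0 : ℚ) < (c₁ : ℚ) := by have h := R2_0; (try simp at h); linarith
  have Rr2_0 : (0 : ℝ) < (c₁ : ℝ) := by exact_mod_cast Rq2_0
  have Rq2_1 : (c₁ : ℚ) < 1 + ((a 4 : ℚ) + (a 5 : ℚ) - (a 7 : ℚ)) := by have h := R2_1; (try simp at h); linarith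
  have Rr2_1 : (c₁ : ℝ) < 1 + ((a 4 : ℝ) + (a 5 : ℝ) - (a 7 : ℝ)) := by exact_mod_cast Rq2_1
  have Rq2_2 : (c₁ : ℚ) < 1 + ((a 1 : ℚ) + (a 2 : ℚ) - (a 3 : ℚ) + (a 5 : ℚ) - (a 7 : ℚ) + 1) := by have h := R2_2; (try simp at h); linarith
  have Rr2_2 : (c₁ : ℝ) < 1 + ((a 1 : ℝ) + (a 2 : ℝ) - (a 3 : ℝ) + (a 5 : ℝ) - (a 7 : ℝ) + 1) := by exact_mod_cast Rq2_2
  have Rq2_3 : (c₁ : ℚ) < 1 + ((a 5 : ℚ)) := by have h := R2_3; (try simp at h); linarith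
  have Rr2_3 : (c₁ : ℝ) < 1 + ((a 5 : ℝ)) := by exact_mod_cast Rq2_3
  have Rq2_4 : (0 : ℚ) < (c₂ : ℚ) := by have h := R2_4; (try simp at h); linarith
  have Rr2_4 : (0 : ℝ) < (c₂ : ℝ) := by exact_mod_cast Rq2_4
  have Rq2_5 : (c₂ : ℚ) < 1 + ((a 6 : ℚ)) := by have h := R2_5; (try simp at h); linarith
  have Rr2_5 : (c₂ : ℝ) < 1 + ((a 6 : ℝ)) := by exact_mod_cast Rq2_5
  have Rq2_6 : (c₂ : ℚ) < 1 + ((a 2 : ℚ) + (a 5 : ℚ) - (a 7 : ℚ)) := by have h := R2_6; (try simp at h); linarith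
  have Rr2_6 : (c₂ : ℝ) < 1 + ((a 2 : ℝ) + (a 5 : ℝ) - (a 7 : ℝ)) := by exact_mod_cast Rq2_6
  have Rq2_7 : (c₂ : ℚ) < 1 + ((a 0 : ℚ) + (a 1 : ℚ) - (a 3 : ℚ) + (a 5 : ℚ) - (a 7 : ℚ)) := by have h := R2_7; (try simp at h); linarith
  have Rr2_7 : (c₂ : ℝ) < 1 + ((a 0 : ℝ) + (a 1 : ℝ) - (a 3 : ℝ) + (a 5 : ℝ) - (a 7 : ℝ)) := by exact_mod_cast Rq2_7
  have Rq2_8 : (1 : ℚ) + ((a 4 : ℚ) + (a 5 : ℚ) - (a 7 : ℚ)) + ((a 0 : ℚ) + (a 1 : ℚ) - (a 3 : ℚ) + (a 5 : ℚ) - (a 7 : ℚ)) - ((a 0 : ℚ) - (a 2 : ℚ) + (a 4 : ℚ)) < (c₁ : ℚ) + (c₂ : ℚ) := by have h := R2_8; (try simp at h); linarith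
  have Rr2_8 : (1 : ℝ) + ((a 4 : ℝ) + (a 5 : ℝ) - (a 7 : ℝ)) + ((a 0 : ℝ) + (a 1 : ℝ) - (a 3 : ℝ) + (a 5 : ℝ) - (a 7 : ℝ)) - ((a 0 : ℝ) - (a 2 : ℝ) + (a 4 : ℝ)) < (c₁ : ℝ) + (c₂ : ℝ) := by exact_mod_cast Rq2_8
  have Rq2_9 : (c₁ : ℚ) + (c₂ : ℚ) < ((a 1 : ℚ) + (a 2 : ℚ) + (a 5 : ℚ) - (a 7 : ℚ)) + 2 := by have h := R2_9; (try simp at h); linarith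
  have Rr2_9 : (c₁ : ℝ) + (c₂ : ℝ) < ((a 1 : ℝ) + (a 2 : ℝ) + (a 5 : ℝ) - (a 7 : ℝ)) + 2 := by exact_mod_cast Rq2_9
  have ZD0 : 0 ≤ a 3 - a 5 + a 7 := by
    have h : (-1 : ℚ) < (a 3 : ℚ) - (a 5 : ℚ) + (a 7 : ℚ) := by linarith
    have h' : (-1 : ℤ) < a 3 - a 5 + a 7 := by exact_mod_cast h
    omega
  have I0 : cellularIntegral a = Jintegral ![a 4 + a 5 - a 7, a 1 + a 2 - a 3 + a 5 - a 7, a 5, a 1 + a 2 + a 5 - a 7, a 6, a 2 + a 5 - a 7, a 0 + a 1 - a 3 + a 5 - a 7] ![a 3, a 4, a 0 - a 2 + a 4, a 0, a 1] := by rw [h8 _ hc0, h10 _ hc0, eP0, eQ0]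
  have I1 : cellularIntegral (a + slotDown 4) = Jintegral ![a 4 + a 5 - a 7 + 1, a 1 + a 2 - a 3 + a 5 - a 7, a 5, a 1 + a 2 + a 5 - a 7, a 6, a 2 + a 5 - a 7, a 0 + a 1 - a 3 + a 5 - a 7] ![a 3, a 4 + 1, a 0 - a 2 + a 4 + 1, a 0, a 1] := by rw [h8 _ hc1, h10 _ hc1, eP1, eQ1]
  have I2 : cellularIntegral (a + slotDown 3) = Jintegral ![a 4 + a 5 - a 7, a 1 + a 2 - a 3 + a 5 - a 7 + 1, a 5, a 1 + a 2 + a 5 - a 7, a 6, a 2 + a 5 - a 7, a 0 + a 1 - a 3 + a 5 - a 7] ![a 3 - 1, a 4 + 1, a 0 - a 2 + a 4, a 0, a 1] := by rw [h8 _ hc2, h10 _ hc2, eP2, eQ2]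
  have M := jsum_of_kernel hF2 (Pv_star34 a) (Qv_star34 a) n1v_star34 n2v_star34 (κv_star34 a) c₁ c₂
    (by intro i j; fin_cases i <;> fin_cases j <;> simp [Pv_star34] <;> omega)
    (by intro i j; fin_cases i <;> fin_cases j <;> simp [Qv_star34] <;> omega)
    (by
      intro i; fin_cases i
      · simpa [Pv_star34, Qv_star34, n1v_star34, n2v_star34] using hch0
      · simpa [Pv_star34, Qv_star34, n1v_star34, n2v_star34] using hch1
      · simpa [Pv_star34, Qv_star34, n1v_star34, n2v_star34] using hch2)
    (by
      intro y
      exact kernel_star34_sum a _ _ (by exact_mod_cast (show (a 4 + 1 : ℤ) ≠ 0 by omega)) (by exact_mod_cast (show (a 4 + a 5 - a 7 + 1 : ℤ) ≠ 0 by omega)) (by exact_mod_cast (show (a 3 : ℤ) ≠ 0 by omega)) (by apply ne_zero_of_re_ne; simp; first | done | (intro hc; linarith)) (by apply ne_zero_of_re_ne; simp; first | done | (intro hc; linarith)) (by apply ne_zero_of_re_ne; simp; first | done | (intro hc; linarith)))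
  simp only [Fin.sum_univ_succ, Fin.sum_univ_zero, add_zero, Pv_star34, Qv_star34, κv_star34,
    Matrix.cons_val_zero, Matrix.cons_val_succ] at M
  have K0 : (Complex.Gamma ((a 3 : ℂ) + 1) * Complex.Gamma ((a 4 : ℂ) + 1) * Complex.Gamma ((a 0 : ℂ) + 1) * Complex.Gamma ((a 1 : ℂ) + 1) / (Complex.Gamma ((a 4 : ℂ) + (a 5 : ℂ) - (a 7 : ℂ) + 1) * Complex.Gamma ((a 0 : ℂ) + (a 1 : ℂ) - (a 3 : ℂ) + (a 5 : ℂ) - (a 7 : ℂ) + 1) * Complex.Gamma ((a 3 : ℂ) - (a 5 : ℂ) + (a 7 : ℂ) + 1))) = (barnesPrefactor ![a 4 + a 5 - a 7, a 1 + a 2 - a 3 + a 5 - a 7, a 5, a 1 + a 2 + a 5 - a 7, a 6, a 2 + a 5 - a 7, a 0 + a 1 - a 3 + a 5 - a 7] ![a 3, a 4, a 0 - a 2 + a 4, a 0, a 1] : ℂ) := by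
    rw [barnesPrefactor_gamma' ![a 4 + a 5 - a 7, a 1 + a 2 - a 3 + a 5 - a 7, a 5, a 1 + a 2 + a 5 - a 7, a 6, a 2 + a 5 - a 7, a 0 + a 1 - a 3 + a 5 - a 7] ![a 3, a 4, a 0 - a 2 + a 4, a 0, a 1] (a 3) (a 4) (a 0) (a 1) (a 4 + a 5 - a 7) (a 0 + a 1 - a 3 + a 5 - a 7) (a 3 - a 5 + a 7)
      (by simp) (by simp) (by simp) (by simp) (by simp) (by simp) (by simp <;> omega)
      (by omega) (by omega) (by omega) (by omega) (by omega) (by omega) (by omega)]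
    push_cast; ring_nf
  have K1 : (Complex.Gamma ((a 3 : ℂ) + 1) * Complex.Gamma ((a 4 : ℂ) + 2) * Complex.Gamma ((a 0 : ℂ) + 1) * Complex.Gamma ((a 1 : ℂ) + 1) / (Complex.Gamma ((a 4 : ℂ) + (a 5 : ℂ) - (a 7 : ℂ) + 2) * Complex.Gamma ((a 0 : ℂ) + (a 1 : ℂ) - (a 3 : ℂ) + (a 5 : ℂ) - (a 7 : ℂ) + 1) * Complex.Gamma ((a 3 : ℂ) - (a 5 : ℂ) + (a 7 : ℂ) + 1))) = (barnesPrefactor ![a 4 + a 5 - a 7 + 1, a 1 + a 2 - a 3 + a 5 - a 7, a 5, a 1 + a 2 + a 5 - a 7, a 6, a 2 + a 5 - a 7, a 0 + a 1 - a 3 + a 5 - a 7] ![a 3, a 4 + 1, a 0 - a 2 + a 4 + 1, a 0, a 1] : ℂ) := by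
    rw [barnesPrefactor_gamma' ![a 4 + a 5 - a 7 + 1, a 1 + a 2 - a 3 + a 5 - a 7, a 5, a 1 + a 2 + a 5 - a 7, a 6, a 2 + a 5 - a 7, a 0 + a 1 - a 3 + a 5 - a 7] ![a 3, a 4 + 1, a 0 - a 2 + a 4 + 1, a 0, a 1] (a 3) (a 4 + 1) (a 0) (a 1) (a 4 + a 5 - a 7 + 1) (a 0 + a 1 - a 3 + a 5 - a 7) (a 3 - a 5 + a 7)
      (by simp) (by simp) (by simp) (by simp) (by simp) (by simp) (by simp <;> omega)
      (by omega) (by omega) (by omega) (by omega) (by omega) (by omega) (by omega)]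
    push_cast; ring_nf
  have K2 : (Complex.Gamma ((a 3 : ℂ)) * Complex.Gamma ((a 4 : ℂ) + 2) * Complex.Gamma ((a 0 : ℂ) + 1) * Complex.Gamma ((a 1 : ℂ) + 1) / (Complex.Gamma ((a 4 : ℂ) + (a 5 : ℂ) - (a 7 : ℂ) + 1) * Complex.Gamma ((a 0 : ℂ) + (a 1 : ℂ) - (a 3 : ℂ) + (a 5 : ℂ) - (a 7 : ℂ) + 1) * Complex.Gamma ((a 3 : ℂ) - (a 5 : ℂ) + (a 7 : ℂ) + 1))) = (barnesPrefactor ![a 4 + a 5 - a 7, a 1 + a 2 - a 3 + a 5 - a 7 + 1, a 5, a 1 + a 2 + a 5 - a 7, a 6, a 2 + a 5 - a 7, a 0 + a 1 - a 3 + a 5 - a 7] ![a 3 - 1, a 4 + 1, a 0 - a 2 + a 4, a 0, a 1] : ℂ) := by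
    rw [barnesPrefactor_gamma' ![a 4 + a 5 - a 7, a 1 + a 2 - a 3 + a 5 - a 7 + 1, a 5, a 1 + a 2 + a 5 - a 7, a 6, a 2 + a 5 - a 7, a 0 + a 1 - a 3 + a 5 - a 7] ![a 3 - 1, a 4 + 1, a 0 - a 2 + a 4, a 0, a 1] (a 3 - 1) (a 4 + 1) (a 0) (a 1) (a 4 + a 5 - a 7) (a 0 + a 1 - a 3 + a 5 - a 7) (a 3 - a 5 + a 7)
      (by simp) (by simp) (by simp) (by simp) (by simp) (by simp) (by simp <;> omega)
      (by omega) (by omega) (by omega) (by omega) (by omega) (by omega) (by omega)]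
    push_cast; ring_nf
  rw [K0, K1, K2] at M
  have hK0 : (barnesPrefactor ![a 4 + a 5 - a 7, a 1 + a 2 - a 3 + a 5 - a 7, a 5, a 1 + a 2 + a 5 - a 7, a 6, a 2 + a 5 - a 7, a 0 + a 1 - a 3 + a 5 - a 7] ![a 3, a 4, a 0 - a 2 + a 4, a 0, a 1] : ℂ) ≠ 0 := by exact_mod_cast (barnesPrefactor_pos _ _).ne'
  have hK1 : (barnesPrefactor ![a 4 + a 5 - a 7 + 1, a 1 + a 2 - a 3 + a 5 - a 7, a 5, a 1 + a 2 + a 5 - a 7, a 6, a 2 + a 5 - a 7, a 0 + a 1 - a 3 + a 5 - a 7] ![a 3, a 4 + 1, a 0 - a 2 + a 4 + 1, a 0, a 1] : ℂ) ≠ 0 := by exact_mod_cast (barnesPrefactor_pos _ _).ne'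
  have hK2 : (barnesPrefactor ![a 4 + a 5 - a 7, a 1 + a 2 - a 3 + a 5 - a 7 + 1, a 5, a 1 + a 2 + a 5 - a 7, a 6, a 2 + a 5 - a 7, a 0 + a 1 - a 3 + a 5 - a 7] ![a 3 - 1, a 4 + 1, a 0 - a 2 + a 4, a 0, a 1] : ℂ) ≠ 0 := by exact_mod_cast (barnesPrefactor_pos _ _).ne'
  simp only [mul_div_assoc, div_self hK0, div_self hK1, div_self hK2, mul_one] at M
  have C0 : ((starKappa (bOfA a) 3 4 : ℤ) : ℂ) = ((-(a 1 : ℂ) - (a 2 : ℂ) + (a 3 : ℂ) + (a 4 : ℂ)) * ((a 4 : ℂ) + 1)) := by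
    simp [starKappa, bOfA, -mul_eq_mul_left_iff, -mul_eq_mul_right_iff]
    all_goals (first | done | ring | (push_cast; ring))
  have C1 : ((-fanCoeff (bOfA a) 4 : ℤ) : ℂ) = (-((-(a 1 : ℂ) - (a 2 : ℂ) + (a 3 : ℂ) + (a 4 : ℂ) + (a 7 : ℂ) + 1) * ((a 4 : ℂ) + (a 5 : ℂ) - (a 7 : ℂ) + 1))) := by
    simp [fanCoeff, chiOf, nonEdgePartners, bOfA, -mul_eq_mul_left_iff, -mul_eq_mul_right_iff]
    all_goals (first | done | ring | (push_cast; ring))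
  have C2 : ((fanCoeff (bOfA a) 3 : ℤ) : ℂ) = (((a 3 : ℂ)) * ((a 7 : ℂ) + 1)) := by
    simp [fanCoeff, chiOf, nonEdgePartners, bOfA, -mul_eq_mul_left_iff, -mul_eq_mul_right_iff]
    all_goals (first | done | ring | (push_cast; ring))
  have goalC : ((starKappa (bOfA a) 3 4 : ℤ) : ℂ) * ((Jintegral ![a 4 + a 5 - a 7, a 1 + a 2 - a 3 + a 5 - a 7, a 5, a 1 + a 2 + a 5 - a 7, a 6, a 2 + a 5 - a 7, a 0 + a 1 - a 3 + a 5 - a 7] ![a 3, a 4, a 0 - a 2 + a 4, a 0, a 1] : ℝ) : ℂ) + ((-fanCoeff (bOfA a) 4 : ℤ) : ℂ) * ((Jintegral ![a 4 + a 5 - a 7 + 1, a 1 + a 2 - a 3 + a 5 - a 7, a 5, a 1 + a 2 + a 5 - a 7, a 6, a 2 + a 5 - a 7, a 0 + a 1 - a 3 + a 5 - a 7] ![a 3, a 4 + 1, a 0 - a 2 + a 4 + 1, a 0, a 1] : ℝ) : ℂ) + ((fanCoeff (bOfA a) 3 : ℤ) : ℂ) * ((Jintegral ![a 4 + a 5 -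 a 7, a 1 + a 2 - a 3 + a 5 - a 7 + 1, a 5, a 1 + a 2 + a 5 - a 7, a 6, a 2 + a 5 - a 7, a 0 + a 1 - a 3 + a 5 - a 7] ![a 3 - 1, a 4 + 1, a 0 - a 2 + a 4, a 0, a 1] : ℝ) : ℂ) = 0 := by
    rw [C0, C1, C2]
    linear_combination M
  unfold ThreeTermRel
  rw [I0, I1, I2]
  exact_mod_cast goalC

end Summit.KontsevichZagierPeriods.Zeta5Search.WedgeDictionary.KernelCells
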